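import Literature.Probability.RandomPlanarGeometry.SAWWordBridges
import Literature.Probability.RandomPlanarGeometry.SAWUnfoldingStep
import Literature.Probability.RandomPlanarGeometry.SAWBridges
import Literature.Probability.RandomPlanarGeometry.SelfAvoidingWalk
import Mathlib.Analysis.SpecialFunctions.Exp
import HarnessLib

/-!
# The bridge generating function is unbounded below `x_c` (Madras–Slade Corollary 3.1.8)

Crux `CriticalBubbleBound` (route `SAWTotalPositivity`), line `kesten-product-renewal-dictionary`,
stub H3, in the step-word model of `SAWWords.lean` / `SAWWordBridges.lean`.

We prove: **if** the Hammersley–Welsh product bound holds — for every `x ≥ 0` and all `N`, `h`,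
the mass `∑ x^{|w|}` of the self-avoiding half-space words `w` of length `≤ N` whose maximal
first coordinate is `≤ h` is at most `∏_{a=1}^{h} (1 + B_{a,N}(x))`, where `B_{a,N}(x)` is the
mass of the self-avoiding bridge words of span `a` and length `≤ N` (Madras–Slade 1993, §3.1,
(3.1.13); stub H2 of this line, taken here as the hypothesis) — **then** the bridge generating
function `B(x) = ∑_{w bridge} x^{|w|}` is unbounded as `x ↑ x_c = 1/μ`: for every real `M`
there are `0 < x < x_c` and `N` with `M ≤ ∑_{|w| ≤ N, w bridge} x^{|w|}` (Madras–Slade 1993,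
Corollary 3.1.8, `B(z_c) = +∞`; equivalently `μ_bridge = μ`).

**Proof** (Madras–Slade §3.1, proof of Theorem 3.1.1), with finite sums of reals only. Suppose
`∑_{|w| ≤ N, w bridge} x^{|w|} < M` for all `0 < x < x_c` and all `N`.
* `halfSpaceCount_le_card_filter_maxLevel`: the `k`-step half-space walks (vertex functions,
  `Zd.halfSpaceWalks 2 k`, counted by `h_k = Zd.halfSpaceCount 2 k`) inject into the
  self-avoiding half-space words of length `k` (`wordOf` / `traj_wordOf`), all of which have
  maximal first coordinate `≤ k`; so `∑_{k ≤ K} h_k x^k` is at most the half-space word mass with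
  `N = h = K` (`sum_halfSpaceCount_mul_pow_le_wordMass`), hence at most
  `∏_{a=1}^{K} (1 + B_{a,K}(x)) ≤ exp (∑_{a=1}^{K} B_{a,K}(x)) ≤ e^M`
  (`prod_one_add_le_exp_of_sum_le`, `sum_Icc_spanMass_le_bridgeMass`).
* `sum_count_mul_pow_le_inv_mul_sq`: from `c_n ≤ ∑_{m=0}^{n} h_{m+1} h_{n-m}`
  (`Zd.count_le_sum_halfSpaceCount`, Madras–Slade (3.1.7)),
  `∑_{n ≤ N} c_n x^n ≤ x⁻¹ (∑_{k ≤ N+1} h_k x^k)²`.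
* With `μ^n ≤ c_n` (`Zd.pow_connectiveConstant_le_count`):
  `∑_{n ≤ N} (μ x)^n ≤ x⁻¹ e^{2M}` for all `0 < x < x_c`; letting `x ↑ x_c = μ⁻¹` gives
  `N + 1 ≤ μ e^{2M}` for every `N`, which is absurd.

## References

* N. Madras, G. Slade, *The Self-Avoiding Walk*, Birkhäuser (1993), §3.1: Theorem 3.1.1,
  eq. (3.1.7), eq. (3.1.13), Corollary 3.1.8.
* J. M. Hammersley, D. J. A. Welsh, *Further results on the rate of convergence to the
  connective constant of the hypercubical lattice*, Quart. J. Math. Oxford (2) 13 (1962) 108–110.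
-/

noncomputable section

open Filter
open scoped Topology
open Literature.Probability.LatticeModels
open Literature.Probability.RandomPlanarGeometry Literature.Probability.RandomPlanarGeometry.SAW
open scoped ENNReal NNReal BigOperators
open Classical

namespace Summit.CriticalPhenomena.SAWScalingLimit.Theorems.CriticalBubbleBound.Kesten.HW

/-! ## Counting transfer: half-space walks inject into half-space words -/

/-- The `k`-step half-space walks from the origin (`Zd.halfSpaceWalks 2 k`, counted by `h_k`)
inject into the self-avoiding half-space words of length `k` by reading off the step word
(`wordOf`, left inverse `traj_wordOf`), and every such word has maximal first coordinate
`≤ k ≤ K` (a `k`-step walk from `0` stays in the box of radius `k`).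
[cite: MadrasSlade1993, Definition 3.1.2] -/
theorem halfSpaceCount_le_card_filter_maxLevel {k K : ℕ} (hkK : k ≤ K) :
    Zd.halfSpaceCount 2 k ≤ ((sawWords k).filter (fun w => Zd.IsHalfSpace w.length (traj w) ∧
      Zd.maxLevel w.length (traj w) ≤ (K : ℤ))).card := by
  unfold Zd.halfSpaceCount
  refine Finset.card_le_card_of_injOn (fun ω => wordOf k ω) (fun ω hω => ?_) ?_
  · rw [Finset.mem_coe, Zd.mem_halfSpaceWalks] at hω
    obtain ⟨hω, hhs⟩ := hω
    obtain ⟨h0, -, hadj, hinj⟩ := Zd.mem_saws.1 hω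
    have hsaw : IsSAW (wordOf k ω) := by
      rw [isSAW_iff_injOn, traj_wordOf hω, length_wordOf]
      exact hinj
    rw [Finset.mem_coe, Finset.mem_filter, mem_sawWords, length_wordOf, traj_wordOf hω]
    refine ⟨⟨rfl, hsaw⟩, hhs, Zd.maxLevel_le fun i hi => ?_⟩
    have h1 := (abs_le.1 (Zd.abs_apply_le_of_adj h0 hadj i hi 0)).2
    omega
  · intro ω hω ω' hω' h
    rw [Finset.mem_coe, Zd.mem_halfSpaceWalks] at hω hω'
    have h' : wordOf k ω = wordOf k ω' := h
    calc ω = traj (wordOf k ω) := (traj_wordOf hω.1).symm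
      _ = traj (wordOf k ω') := by rw [h']
      _ = ω' := traj_wordOf hω'.1

/-- Word finsets filtered out of `sawWords n` for distinct lengths `n` are pairwise disjoint.
[folklore] -/
theorem filter_sawWords_pairwiseDisjoint (s : Set ℕ) (P : List Step → Prop) [DecidablePred P] :
    s.PairwiseDisjoint (fun n => (sawWords n).filter P) := by
  intro m _ n _ hmn
  rw [Function.onFun, Finset.disjoint_left]
  intro w hwm hwn
  exact hmn ((mem_sawWords.1 (Finset.mem_filter.1 hwm).1).1.symm.trans
    (mem_sawWords.1 (Finset.mem_filter.1 hwn).1).1)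

/-- `∑_{k ≤ K} h_k x^k` (`x ≥ 0`) is at most the mass of the self-avoiding half-space words of
length `≤ K` and maximal first coordinate `≤ K`. [cite: MadrasSlade1993, §3.1] -/
theorem sum_halfSpaceCount_mul_pow_le_wordMass {x : ℝ} (hx : 0 ≤ x) (K : ℕ) :
    ∑ k ∈ Finset.range (K + 1), (Zd.halfSpaceCount 2 k : ℝ) * x ^ k ≤
      ∑ w ∈ (Finset.range (K + 1)).biUnion (fun n => (sawWords n).filter (fun w =>
        Zd.IsHalfSpace w.length (traj w) ∧ Zd.maxLevel w.length (traj w) ≤ (K : ℤ))),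
        x ^ w.length := by
  rw [Finset.sum_biUnion (filter_sawWords_pairwiseDisjoint _ _)]
  refine Finset.sum_le_sum fun k hk => ?_
  have hkK : k ≤ K := Nat.le_of_lt_succ (Finset.mem_range.1 hk)
  refine le_trans (mul_le_mul_of_nonneg_right
    (Nat.cast_le.2 (halfSpaceCount_le_card_filter_maxLevel hkK)) (pow_nonneg hx _)) ?_
  rw [← nsmul_eq_mul]
  exact Finset.card_nsmul_le_sum _ _ _ fun w hw => by
    rw [(mem_sawWords.1 (Finset.mem_filter.1 hw).1).1]

/-! ## Elementary estimates -/

/-- `∏ᵢ (1 + tᵢ) ≤ e^M` whenever `tᵢ ≥ 0` and `∑ᵢ tᵢ ≤ M` (from `1 + t ≤ eᵗ`; the product form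
`∏ (1 + tᵢ) ≤ exp (∑ tᵢ)` is `CubicSieve.prod_one_add_le_exp_sum` in the tree). [folklore] -/
theorem prod_one_add_le_exp_of_sum_le {ι : Type*} {s : Finset ι} {f : ι → ℝ} {M : ℝ}
    (hf : ∀ i ∈ s, 0 ≤ f i) (hM : ∑ i ∈ s, f i ≤ M) : ∏ i ∈ s, (1 + f i) ≤ Real.exp M := by
  refine le_trans ?_ (Real.exp_le_exp.2 hM)
  rw [Real.exp_sum]
  exact Finset.prod_le_prod (fun i hi => by linarith [hf i hi]) fun i _ => by
    linarith [Real.add_one_le_exp (f i)]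

/-- The bridge words of length `≤ N` and span `a`, `1 ≤ a ≤ K`, are disjoint parts of the set of
bridge words of length `≤ N`: `∑_{a=1}^{K} B_{a,N}(x) ≤ ∑_{|w| ≤ N, w bridge} x^{|w|}` for
`x ≥ 0`. [folklore] -/
theorem sum_Icc_spanMass_le_bridgeMass {x : ℝ} (hx : 0 ≤ x) (N K : ℕ) :
    ∑ a ∈ Finset.Icc 1 K, ∑ w ∈ (Finset.range (N + 1)).biUnion (fun n => (sawWords n).filter
        (fun w => IsBridgeW w ∧ xEnd w = (a : ℤ))), x ^ w.length ≤
      ∑ w ∈ (Finset.range (N + 1)).biUnion (fun n => (sawWords n).filter (fun w => IsBridgeW w)),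
        x ^ w.length := by
  have hdisj : Set.PairwiseDisjoint (↑(Finset.Icc 1 K) : Set ℕ) (fun a : ℕ =>
      (Finset.range (N + 1)).biUnion (fun n => (sawWords n).filter
        (fun w => IsBridgeW w ∧ xEnd w = (a : ℤ)))) := by
    intro a _ b _ hab
    rw [Function.onFun, Finset.disjoint_left]
    intro w hwa hwb
    simp only [Finset.mem_biUnion, Finset.mem_filter] at hwa hwb
    obtain ⟨_, _, _, _, ha⟩ := hwa
    obtain ⟨_, _, _, _, hb⟩ := hwb
    exact hab (by exact_mod_cast ha.symm.trans hb)
  rw [← Finset.sum_biUnion hdisj]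
  refine Finset.sum_le_sum_of_subset_of_nonneg (fun w hw => ?_) fun _ _ _ => pow_nonneg hx _
  simp only [Finset.mem_biUnion, Finset.mem_filter] at hw ⊢
  obtain ⟨_, _, n, hn, hws, hb, _⟩ := hw
  exact ⟨n, hn, hws, hb⟩

/-- **`∑_{n ≤ N} c_n x^n ≤ x⁻¹ (∑_{k ≤ N+1} h_k x^k)²`** for `x > 0`: multiply
`c_n ≤ ∑_{m=0}^{n} h_{m+1} h_{n-m}` (`Zd.count_le_sum_halfSpaceCount`) by
`x^n = x⁻¹ · x^{m+1} · x^{n-m}` and enlarge the index set `{(m+1, n-m)}` to a square.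
[cite: MadrasSlade1993, §3.1, eq. (3.1.7)] -/
theorem sum_count_mul_pow_le_inv_mul_sq {x : ℝ} (hx : 0 < x) (N : ℕ) :
    ∑ n ∈ Finset.range (N + 1), (Zd.count 2 n : ℝ) * x ^ n ≤
      x⁻¹ * (∑ k ∈ Finset.range (N + 1 + 1), (Zd.halfSpaceCount 2 k : ℝ) * x ^ k) ^ 2 := by
  have hterm : ∀ n : ℕ, (Zd.count 2 n : ℝ) * x ^ n ≤
      ∑ m ∈ Finset.range (n + 1), x⁻¹ * ((Zd.halfSpaceCount 2 (m + 1) : ℝ) * x ^ (m + 1) *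
        ((Zd.halfSpaceCount 2 (n - m) : ℝ) * x ^ (n - m))) := by
    intro n
    have h1 : (Zd.count 2 n : ℝ) ≤ ∑ m ∈ Finset.range (n + 1),
        (Zd.halfSpaceCount 2 (m + 1) : ℝ) * (Zd.halfSpaceCount 2 (n - m) : ℝ) := by
      exact_mod_cast Zd.count_le_sum_halfSpaceCount (d := 2) n
    refine (mul_le_mul_of_nonneg_right h1 (pow_nonneg hx.le n)).trans (le_of_eq ?_)
    rw [Finset.sum_mul]
    refine Finset.sum_congr rfl fun m hm => ?_
    have hmn : m ≤ n := Nat.le_of_lt_succ (Finset.mem_range.1 hm)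
    have hxn : x ^ n = x⁻¹ * (x ^ (m + 1) * x ^ (n - m)) := by
      rw [← pow_add, show m + 1 + (n - m) = n + 1 by omega, pow_succ', ← mul_assoc,
        inv_mul_cancel₀ hx.ne', one_mul]
    rw [hxn]
    ring
  have hnn : ∀ k : ℕ, 0 ≤ (Zd.halfSpaceCount 2 k : ℝ) * x ^ k := fun k => by positivity
  calc ∑ n ∈ Finset.range (N + 1), (Zd.count 2 n : ℝ) * x ^ n
      ≤ ∑ n ∈ Finset.range (N + 1), ∑ m ∈ Finset.range (n + 1),
          x⁻¹ * ((Zd.halfSpaceCount 2 (m + 1) : ℝ) * x ^ (m + 1) *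
            ((Zd.halfSpaceCount 2 (n - m) : ℝ) * x ^ (n - m))) :=
        Finset.sum_le_sum fun n _ => hterm n
    _ = x⁻¹ * ∑ n ∈ Finset.range (N + 1), ∑ m ∈ Finset.range (n + 1),
          (Zd.halfSpaceCount 2 (m + 1) : ℝ) * x ^ (m + 1) *
            ((Zd.halfSpaceCount 2 (n - m) : ℝ) * x ^ (n - m)) := by
        simp only [Finset.mul_sum]
    _ = x⁻¹ * ∑ m ∈ Finset.range (N + 1), ∑ k ∈ Finset.range (N + 1 - m),
          (Zd.halfSpaceCount 2 (m + 1) : ℝ) * x ^ (m + 1) *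
            ((Zd.halfSpaceCount 2 k : ℝ) * x ^ k) := by
        congr 1
        exact Finset.sum_range_diag_flip (N + 1) fun i j =>
          (Zd.halfSpaceCount 2 (i + 1) : ℝ) * x ^ (i + 1) * ((Zd.halfSpaceCount 2 j : ℝ) * x ^ j)
    _ ≤ x⁻¹ * ∑ m ∈ Finset.range (N + 1), ∑ k ∈ Finset.range (N + 1 + 1),
          (Zd.halfSpaceCount 2 (m + 1) : ℝ) * x ^ (m + 1) *
            ((Zd.halfSpaceCount 2 k : ℝ) * x ^ k) :=
        mul_le_mul_of_nonneg_left (Finset.sum_le_sum fun m _ =>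
          Finset.sum_le_sum_of_subset_of_nonneg (Finset.range_subset_range.2 (by omega))
            fun k _ _ => mul_nonneg (hnn (m + 1)) (hnn k)) (inv_nonneg.2 hx.le)
    _ = x⁻¹ * ((∑ m ∈ Finset.range (N + 1), (Zd.halfSpaceCount 2 (m + 1) : ℝ) * x ^ (m + 1)) *
          ∑ k ∈ Finset.range (N + 1 + 1), (Zd.halfSpaceCount 2 k : ℝ) * x ^ k) := by
        rw [Finset.sum_mul_sum]
    _ ≤ x⁻¹ * ((∑ k ∈ Finset.range (N + 1 + 1), (Zd.halfSpaceCount 2 k : ℝ) * x ^ k) *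
          ∑ k ∈ Finset.range (N + 1 + 1), (Zd.halfSpaceCount 2 k : ℝ) * x ^ k) := by
        refine mul_le_mul_of_nonneg_left (mul_le_mul_of_nonneg_right ?_
          (Finset.sum_nonneg fun k _ => hnn k)) (inv_nonneg.2 hx.le)
        have hs : ∑ k ∈ Finset.range (N + 1 + 1), (Zd.halfSpaceCount 2 k : ℝ) * x ^ k =
            ∑ m ∈ Finset.range (N + 1), (Zd.halfSpaceCount 2 (m + 1) : ℝ) * x ^ (m + 1) +
              (Zd.halfSpaceCount 2 0 : ℝ) * x ^ 0 :=
          Finset.sum_range_succ' _ _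
        rw [hs]
        linarith [hnn 0]
    _ = x⁻¹ * (∑ k ∈ Finset.range (N + 1 + 1), (Zd.halfSpaceCount 2 k : ℝ) * x ^ k) ^ 2 := by
        rw [sq]

/-! ## Madras–Slade Corollary 3.1.8 in the word model -/

/-- **The bridge generating function is unbounded below `x_c`** (word model of Madras–Slade,
Corollary 3.1.8), conditionally on the Hammersley–Welsh product bound (3.1.13) supplied as the
hypothesis: for every `M` there are `0 < x < x_c` and `N` with
`M ≤ ∑_{|w| ≤ N, w a self-avoiding bridge word} x^{|w|}`. By contradiction: a uniform bound `M`
would give `∑_{k ≤ K} h_k x^k ≤ e^M`, then `∑_{n ≤ N} (μx)^n ≤ ∑_{n ≤ N} c_n x^n ≤ x⁻¹ e^{2M}` for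
all `0 < x < x_c`, and `N + 1 ≤ μ e^{2M}` for all `N` in the limit `x ↑ x_c = μ⁻¹`.
[cite: MadrasSlade1993, Corollary 3.1.8] -/
theorem bridgeWordSeries_unbounded : (∀ x : ℝ, 0 ≤ x → ∀ N h : ℕ,
    (∑ w ∈ (Finset.range (N + 1)).biUnion (fun n => (sawWords n).filter
      (fun w => Zd.IsHalfSpace w.length (traj w) ∧ Zd.maxLevel w.length (traj w) ≤ (h : ℤ))),
      x ^ w.length) ≤ ∏ a ∈ Finset.Icc 1 h, (1 + ∑ w ∈ (Finset.range (N + 1)).biUnion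
      (fun n => (sawWords n).filter (fun w => IsBridgeW w ∧ xEnd w = (a : ℤ))), x ^ w.length)) →
    ∀ M : ℝ, ∃ x : ℝ, 0 < x ∧ x < criticalFugacity ∧ ∃ N : ℕ,
      M ≤ ∑ w ∈ (Finset.range (N + 1)).biUnion (fun n => (sawWords n).filter
        (fun w => IsBridgeW w)), x ^ w.length := by
  intro hH2 M
  by_contra hneg
  push Not at hneg
  have hμ : 0 < connectiveConstant := by
    have h := Zd.connectiveConstant_pos 2
    rwa [Zd.connectiveConstant_two] at h
  have hxc : 0 < criticalFugacity := inv_pos.2 hμ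
  -- (1) `∑_{k ≤ K} h_k x^k ≤ e^M` for `0 < x < x_c` and every `K`
  have hHF : ∀ x : ℝ, 0 < x → x < criticalFugacity → ∀ K : ℕ,
      ∑ k ∈ Finset.range (K + 1), (Zd.halfSpaceCount 2 k : ℝ) * x ^ k ≤ Real.exp M := by
    intro x hx0 hx1 K
    refine (sum_halfSpaceCount_mul_pow_le_wordMass hx0.le K).trans
      ((hH2 x hx0.le K K).trans ?_)
    exact prod_one_add_le_exp_of_sum_le
      (fun a _ => Finset.sum_nonneg fun w _ => pow_nonneg hx0.le _)
      ((sum_Icc_spanMass_le_bridgeMass hx0.le K K).trans (hneg x hx0 hx1 K).le)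
  -- (2) `∑_{n ≤ N} (μ x)^n ≤ x⁻¹ e^{2M}` for `0 < x < x_c` and every `N`
  have hkey : ∀ N : ℕ, ∀ x : ℝ, 0 < x → x < criticalFugacity →
      ∑ n ∈ Finset.range (N + 1), (connectiveConstant * x) ^ n ≤ x⁻¹ * Real.exp M ^ 2 := by
    intro N x hx0 hx1
    calc ∑ n ∈ Finset.range (N + 1), (connectiveConstant * x) ^ n
        ≤ ∑ n ∈ Finset.range (N + 1), (Zd.count 2 n : ℝ) * x ^ n := by
          refine Finset.sum_le_sum fun n _ => ?_
          rw [mul_pow]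
          refine mul_le_mul_of_nonneg_right ?_ (pow_nonneg hx0.le n)
          have h := Zd.pow_connectiveConstant_le_count 2 n
          rwa [Zd.connectiveConstant_two] at h
      _ ≤ x⁻¹ * (∑ k ∈ Finset.range (N + 1 + 1), (Zd.halfSpaceCount 2 k : ℝ) * x ^ k) ^ 2 :=
          sum_count_mul_pow_le_inv_mul_sq hx0 N
      _ ≤ x⁻¹ * Real.exp M ^ 2 :=
          mul_le_mul_of_nonneg_left (pow_le_pow_left₀ (Finset.sum_nonneg fun k _ => by positivity)
            (hHF x hx0 hx1 (N + 1)) 2) (inv_nonneg.2 hx0.le)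
  -- (3) let `x ↑ x_c = μ⁻¹`: `N + 1 ≤ x_c⁻¹ e^{2M}` for every `N`
  have hlim : ∀ N : ℕ, (N : ℝ) + 1 ≤ criticalFugacity⁻¹ * Real.exp M ^ 2 := by
    intro N
    have hμxc : connectiveConstant * criticalFugacity = 1 := mul_inv_cancel₀ hμ.ne'
    have hc : Continuous fun x : ℝ => ∑ n ∈ Finset.range (N + 1), (connectiveConstant * x) ^ n :=
      continuous_finsetSum _ fun n _ => (continuous_const.mul continuous_id).pow n
    have hval : ∑ n ∈ Finset.range (N + 1), (connectiveConstant * criticalFugacity) ^ n =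
        (N : ℝ) + 1 := by
      rw [hμxc]
      simp
    have h1 : Tendsto (fun x : ℝ => ∑ n ∈ Finset.range (N + 1), (connectiveConstant * x) ^ n)
        (𝓝[<] criticalFugacity) (𝓝 ((N : ℝ) + 1)) := by
      rw [← hval]
      exact (hc.tendsto criticalFugacity).mono_left nhdsWithin_le_nhds
    have h2 : Tendsto (fun x : ℝ => x⁻¹ * Real.exp M ^ 2) (𝓝[<] criticalFugacity)
        (𝓝 (criticalFugacity⁻¹ * Real.exp M ^ 2)) :=
      ((tendsto_inv₀ hxc.ne').mul_const _).mono_left nhdsWithin_le_nhds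
    refine le_of_tendsto_of_tendsto h1 h2 ?_
    filter_upwards [Ioo_mem_nhdsLT hxc] with x hx
    exact hkey N x hx.1 hx.2
  obtain ⟨N, hN⟩ := exists_nat_gt (criticalFugacity⁻¹ * Real.exp M ^ 2)
  have h := hlim N
  linarith

end Summit.CriticalPhenomena.SAWScalingLimit.Theorems.CriticalBubbleBound.Kesten.HW

end
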